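import Summits.Schanuel.Schanuel.Theorems.ZilberEacRelationBoundedPlace
import Summits.Schanuel.Schanuel.Theorems.ZilberEacMinimalPolynomialDomain
import Summits.Schanuel.Schanuel.Theorems.ZilberEacFibreCurveCylinderAll
import HarnessLib

/-!
# Arbitrary base branches, CIII: EVERY SURFACE OF MANTOVA–MASSER'S CASE OVER A CURVE WITH A
# HORIZONTAL ASYMPTOTE THAT IS NOT A `y₀`-CYLINDER HAS ZARISKI-DENSE EXPONENTIAL POINTS (O91)

HONEST FRAMING.  Cell `pub-schanuel` (Zilber's Exponential-Algebraic Closedness, case ladder;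
host summit Schanuel), seat 2, gen 33.  File CI decided, in S-form, the surfaces given by one
relation `G(x₀, x₁, y₁; y₀) = 0` along a bounded place.  Here the `∀ W` form: for an irreducible
`F ∈ ℂ[x₀][x₁]` (ANY coefficients) of `x₁`-degree `≥ 2` whose top row has a root (a horizontal
asymptote `x₁ → θ`), EVERY surface `W` of Mantova–Masser's case with base curve `{F = 0}` on which
`x₀, x₁, y₁` satisfy no relation other than the multiples of `F` (i.e. `W` is not algebraic in
`y₁` over the curve — the complementary case, `y₀`-cylinders, is file XCVIII over `ℚ̄`) has
Zariski-dense exponential points: **`unprojectedDense_of_mmCase_topRowRoot`**.  Proof: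
`ℂ[x₀,x₁,y₀,y₁] = B[y₀]` with `B = ℂ[x₀,x₁,y₁]`; the minimal polynomial `P_W ∈ B[y₀]` of
`𝔭 = I(W)` over the prime `F ∈ B` (file CII) exists because `𝔭 ≠ (F)` (dimension `2 ≠ 3`), and
divides `𝔭` modulo `F`, so `W` contains every point `(x, y₀, e^{x₁})` with `x ∈ C`,
`lc(x, e^{x₁}) ≠ 0`, `y₀ ≠ 0`, `P_W(x, e^{x₁}; y₀) = 0`; file CI applies with `S = W`.
What this is NOT: `y₀`-cylinders over non-`ℚ̄` curves; curves without a horizontal asymptote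
(e.g. `x₁² = x₀³ + 1`); Fib(3,2); EC(3,2) — OPEN; the question OPEN in general; NOT Schanuel's
conjecture (neither used nor implied); EAC ⇏ SC.
-/

noncomputable section

open Filter Topology Set Complex Polynomial
open Literature.NumberTheory.Transcendental Literature.ModelTheory.Zilber
open Literature.ModelTheory.ExponentialFields

set_option linter.dupNamespace false

namespace Summit.Schanuel.Schanuel.Theorems

section RelationAllSurfaces

/-! ## Part A. `ℂ[x₀, x₁, y₀, y₁] = ℂ[x₀, x₁, y₁][y₀]` -/

variable (ι : Polynomial (MvPolynomial (Fin 3) ℂ) →+* MvPolynomial (Fin 2 ⊕ Fin 2) ℂ)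

/-- Evaluation of the embedded polynomial, from the values of `ι` on generators. [folklore] -/
theorem eval_embed₄ (hC : ∀ a : ℂ, ι (Polynomial.C (MvPolynomial.C a)) = MvPolynomial.C a)
    (h0 : ι (Polynomial.C (MvPolynomial.X 0)) = MvPolynomial.X (Sum.inl 0))
    (h1 : ι (Polynomial.C (MvPolynomial.X 1)) = MvPolynomial.X (Sum.inl 1))
    (h2 : ι (Polynomial.C (MvPolynomial.X 2)) = MvPolynomial.X (Sum.inr 1))
    (hX : ι Polynomial.X = MvPolynomial.X (Sum.inr 0)) (w : Fin 2 ⊕ Fin 2 → ℂ)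
    (G : Polynomial (MvPolynomial (Fin 3) ℂ)) :
    MvPolynomial.eval w (ι G) =
      (G.map (MvPolynomial.eval ![w (Sum.inl 0), w (Sum.inl 1), w (Sum.inr 1)])).eval (w (Sum.inr 0)) := by
  have e₁ : (MvPolynomial.eval w).comp (ι.comp Polynomial.C) =
      MvPolynomial.eval ![w (Sum.inl 0), w (Sum.inl 1), w (Sum.inr 1)] := by
    refine MvPolynomial.ringHom_ext (fun a => ?_) (fun i => ?_)
    · simp only [RingHom.comp_apply, hC, MvPolynomial.eval_C]
    · rw [RingHom.comp_apply, RingHom.comp_apply, MvPolynomial.eval_X]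
      fin_cases i
      · show MvPolynomial.eval w (ι (Polynomial.C (MvPolynomial.X 0))) = _; rw [h0]; simp
      · show MvPolynomial.eval w (ι (Polynomial.C (MvPolynomial.X 1))) = _; rw [h1]; simp
      · show MvPolynomial.eval w (ι (Polynomial.C (MvPolynomial.X 2))) = _; rw [h2]; simp
  have e₂ : (MvPolynomial.eval w).comp ι = Polynomial.eval₂RingHom
      (MvPolynomial.eval ![w (Sum.inl 0), w (Sum.inl 1), w (Sum.inr 1)]) (w (Sum.inr 0)) := by
    refine Polynomial.ringHom_ext (fun g => ?_) ?_
    · have h := congrArg (fun f : MvPolynomial (Fin 3) ℂ →+* ℂ => f g) e₁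
      simp only [RingHom.comp_apply] at h
      rw [RingHom.comp_apply, h, Polynomial.coe_eval₂RingHom, Polynomial.eval₂_C]
    · simp only [RingHom.comp_apply, hX, MvPolynomial.eval_X, Polynomial.coe_eval₂RingHom,
        Polynomial.eval₂_X]
  have h := congrArg (fun f : Polynomial (MvPolynomial (Fin 3) ℂ) →+* ℂ => f G) e₂
  simp only [RingHom.comp_apply] at h
  rw [h, Polynomial.coe_eval₂RingHom, Polynomial.eval_map]

/-- `ι` is onto: every four-variable polynomial is `Σ_m ι(G_m) y₀^m`. [folklore] -/
theorem exists_embed₄_poly (hC : ∀ a : ℂ, ι (Polynomial.C (MvPolynomial.C a)) = MvPolynomial.C a)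
    (h0 : ι (Polynomial.C (MvPolynomial.X 0)) = MvPolynomial.X (Sum.inl 0))
    (h1 : ι (Polynomial.C (MvPolynomial.X 1)) = MvPolynomial.X (Sum.inl 1))
    (h2 : ι (Polynomial.C (MvPolynomial.X 2)) = MvPolynomial.X (Sum.inr 1))
    (hX : ι Polynomial.X = MvPolynomial.X (Sum.inr 0)) (G : MvPolynomial (Fin 2 ⊕ Fin 2) ℂ) :
    ∃ Gy : Polynomial (MvPolynomial (Fin 3) ℂ), ι Gy = G := by
  induction G using MvPolynomial.induction_on with
  | C a => exact ⟨Polynomial.C (MvPolynomial.C a), hC a⟩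
  | add p q hp hq =>
    obtain ⟨Gp, hGp⟩ := hp
    obtain ⟨Gq, hGq⟩ := hq
    exact ⟨Gp + Gq, by rw [map_add, hGp, hGq]⟩
  | mul_X p i hp =>
    obtain ⟨Gp, hGp⟩ := hp
    rcases i with i | i <;> fin_cases i
    · exact ⟨Gp * Polynomial.C (MvPolynomial.X 0), by rw [map_mul, hGp, h0]; rfl⟩
    · exact ⟨Gp * Polynomial.C (MvPolynomial.X 1), by rw [map_mul, hGp, h1]; rfl⟩
    · exact ⟨Gp * Polynomial.X, by rw [map_mul, hGp, hX]; rfl⟩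
    · exact ⟨Gp * Polynomial.C (MvPolynomial.X 2), by rw [map_mul, hGp, h2]; rfl⟩

/-! ## Part B. The theorem -/

variable (F : ℂ[X][X])

/-- **Every surface of the case over a curve with a horizontal asymptote that is not algebraic in
`y₁` is dense.**  `F` irreducible of `x₁`-degree `≥ 2` with a root of its top row; `F₃` = `F` in
`ℂ[x₀, x₁, y₁]` (through its values); `W` in Mantova–Masser's case with base curve `{F = 0}`
such that every `H ∈ ℂ[x₀, x₁, y₁]` vanishing on `W` (with `y₁` the second multiplicative
coordinate) is divisible by `F₃`.  Then the unprojected exponential points are Zariski dense in `W`.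
[cite: MantovaMasser2023, §1 Further remarks, p. 5 (the question, open in general)] (new) -/
theorem unprojectedDense_of_mmCase_topRowRoot (hFirr : Irreducible F) (hn : 2 ≤ F.natDegree)
    (N : ℕ) (hN : ∀ j, (F.coeff j).natDegree ≤ N) (T : ℂ[X])
    (hT : ∀ j, T.coeff j = (F.coeff j).coeff N) (hT0 : T ≠ 0) {θ : ℂ} (hTθ : T.IsRoot θ)
    (F₃ : MvPolynomial (Fin 3) ℂ)
    (hF₃ : ∀ v : Fin 3 → ℂ, MvPolynomial.eval v F₃ = (F.map (Polynomial.evalRingHom (v 0))).eval (v 1))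
    {W : Set (Fin 2 ⊕ Fin 2 → ℂ)} (hmm : MMCaseDimPiOneFree W)
    (hbase : MvPolynomial.zeroLocus ℂ (MvPolynomial.vanishingIdeal ℂ (projAdd '' (W ∩ torusLocus ℂ 2))) =
      {x : Fin 2 → ℂ | (F.map (Polynomial.evalRingHom (x 0))).eval (x 1) = 0})
    (hfree : ∀ H : MvPolynomial (Fin 3) ℂ,
      (∀ w ∈ W, MvPolynomial.eval ![w (Sum.inl 0), w (Sum.inl 1), w (Sum.inr 1)] H = 0) → F₃ ∣ H) :
    UnprojectedDense W := by
  classical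
  -- the embedding `ι : B[y₀] → ℂ[x₀, x₁, y₀, y₁]`, `B = ℂ[x₀, x₁, y₁]`
  set ι : Polynomial (MvPolynomial (Fin 3) ℂ) →+* MvPolynomial (Fin 2 ⊕ Fin 2) ℂ :=
    Polynomial.eval₂RingHom (MvPolynomial.eval₂Hom (S₁ := MvPolynomial (Fin 2 ⊕ Fin 2) ℂ)
      MvPolynomial.C (![MvPolynomial.X (Sum.inl 0), MvPolynomial.X (Sum.inl 1),
        MvPolynomial.X (Sum.inr 1)] : Fin 3 → MvPolynomial (Fin 2 ⊕ Fin 2) ℂ))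
      (MvPolynomial.X (Sum.inr 0)) with hι
  have hC : ∀ a : ℂ, ι (Polynomial.C (MvPolynomial.C a)) = MvPolynomial.C a := by
    intro a
    simp only [hι, Polynomial.coe_eval₂RingHom, Polynomial.eval₂_C, MvPolynomial.coe_eval₂Hom,
      MvPolynomial.eval₂_C]
  have h0 : ι (Polynomial.C (MvPolynomial.X 0)) = MvPolynomial.X (Sum.inl 0) := by
    simp only [hι, Polynomial.coe_eval₂RingHom, Polynomial.eval₂_C, MvPolynomial.coe_eval₂Hom,
      MvPolynomial.eval₂_X, Matrix.cons_val_zero]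
  have h1 : ι (Polynomial.C (MvPolynomial.X 1)) = MvPolynomial.X (Sum.inl 1) := by
    simp only [hι, Polynomial.coe_eval₂RingHom, Polynomial.eval₂_C, MvPolynomial.coe_eval₂Hom,
      MvPolynomial.eval₂_X, Matrix.cons_val_one, Matrix.cons_val_zero]
  have h2 : ι (Polynomial.C (MvPolynomial.X 2)) = MvPolynomial.X (Sum.inr 1) := by
    simp only [hι, Polynomial.coe_eval₂RingHom, Polynomial.eval₂_C, MvPolynomial.coe_eval₂Hom,
      MvPolynomial.eval₂_X]; rfl
  have hX : ι Polynomial.X = MvPolynomial.X (Sum.inr 0) := by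
    simp only [hι, Polynomial.coe_eval₂RingHom, Polynomial.eval₂_X]
  have hev := eval_embed₄ ι hC h0 h1 h2 hX
  -- the prime `𝔭 = I(W)`
  set 𝔭 : Ideal (MvPolynomial (Fin 2 ⊕ Fin 2) ℂ) := MvPolynomial.vanishingIdeal ℂ W with h𝔭
  haveI h𝔭p : 𝔭.IsPrime := hmm.1.2
  have hmem : ∀ G : Polynomial (MvPolynomial (Fin 3) ℂ), ι G ∈ 𝔭 ↔ ∀ w ∈ W,
      (G.map (MvPolynomial.eval ![w (Sum.inl 0), w (Sum.inl 1), w (Sum.inr 1)])).eval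
        (w (Sum.inr 0)) = 0 := by
    intro G
    rw [h𝔭, MvPolynomial.mem_vanishingIdeal_iff]
    refine forall₂_congr fun w _ => ?_
    rw [MvPolynomial.aeval_eq_eval, hev]
  obtain ⟨w₀, hw₀W, hw₀T⟩ := hmm.2.1
  have hy : ∀ i : Fin 2, (MvPolynomial.X (Sum.inr i) : MvPolynomial (Fin 2 ⊕ Fin 2) ℂ) ∉ 𝔭 := by
    intro i hi
    rw [h𝔭, MvPolynomial.mem_vanishingIdeal_iff] at hi
    have h := hi w₀ hw₀W
    rw [MvPolynomial.aeval_eq_eval, MvPolynomial.eval_X] at h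
    exact (mem_torusLocus_iff.1 hw₀T) i h
  have hXmem : ι Polynomial.X ∉ 𝔭 := by rw [hX]; exact hy 0
  -- `F ∈ 𝔭`
  have hFW : ∀ w ∈ W, w ∈ torusLocus ℂ 2 →
      (F.map (Polynomial.evalRingHom (w (Sum.inl 0)))).eval (w (Sum.inl 1)) = 0 := by
    intro w hwW hwT
    have hcl : projAdd w ∈ MvPolynomial.zeroLocus ℂ
        (MvPolynomial.vanishingIdeal ℂ (projAdd '' (W ∩ torusLocus ℂ 2))) :=
      MvPolynomial.zeroLocus_vanishingIdeal_le _ ⟨w, ⟨hwW, hwT⟩, rfl⟩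
    rw [hbase] at hcl
    exact hcl
  have hFmem : ι (Polynomial.C F₃) ∈ 𝔭 := by
    have hprod : ι (Polynomial.C F₃) * MvPolynomial.X (Sum.inr 0) * MvPolynomial.X (Sum.inr 1) ∈ 𝔭 := by
      rw [h𝔭, MvPolynomial.mem_vanishingIdeal_iff]
      intro w hwW
      rw [MvPolynomial.aeval_eq_eval, map_mul, map_mul, hev, MvPolynomial.eval_X, MvPolynomial.eval_X,
        Polynomial.map_C, Polynomial.eval_C, hF₃]
      simp only [Matrix.cons_val_zero, Matrix.cons_val_one]
      by_cases hwT : w ∈ torusLocus ℂ 2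
      · rw [hFW w hwW hwT, zero_mul, zero_mul]
      · rw [mem_torusLocus_iff] at hwT
        push Not at hwT
        obtain ⟨i, hi⟩ := hwT
        fin_cases i
        · simp only [Fin.zero_eta] at hi; rw [hi, mul_zero, zero_mul]
        · simp only [Fin.mk_one] at hi; rw [hi, mul_zero]
    rcases h𝔭p.mem_or_mem hprod with h | h
    · exact (h𝔭p.mem_or_mem h).elim id fun h' => (hy 0 h').elim
    · exact (hy 1 h).elim
  have hconst : ∀ H : MvPolynomial (Fin 3) ℂ, ι (Polynomial.C H) ∈ 𝔭 → F₃ ∣ H := by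
    intro H hH
    refine hfree H fun w hw => ?_
    have h := (hmem _).1 hH w hw
    rwa [Polynomial.map_C, Polynomial.eval_C] at h
  -- `F₃` is prime
  obtain ⟨Φr, hΦr⟩ := exists_rowsEquiv
  have hF₃eq : F₃ = MvPolynomial.rename (Fin.castSucc : Fin 2 → Fin 3) (Φr.symm F) := by
    refine MvPolynomial.funext fun v => ?_
    rw [hF₃, MvPolynomial.eval_rename]
    have e : (v ∘ (Fin.castSucc : Fin 2 → Fin 3)) = ![v 0, v 1] := by
      funext i; fin_cases i <;> rfl
    rw [e, hΦr, RingEquiv.apply_symm_apply]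
  have hirrA : Irreducible (Φr.symm F) := by
    refine (irreducible_rows_iff (Q := F) fun x y => ?_).2 hFirr
    rw [hΦr, RingEquiv.apply_symm_apply]
  have hprimeF₃ : Prime F₃ := by
    rw [hF₃eq]
    exact UniqueFactorizationMonoid.irreducible_iff_prime.1 (irreducible_rename_castSucc₂ hirrA)
  -- a relation with a coefficient `∉ (F₃)` exists: otherwise `𝔭 = (F̃)` and `dim W = 3`
  have hP₀ : ∃ P₀ : Polynomial (MvPolynomial (Fin 3) ℂ), ι P₀ ∈ 𝔭 ∧ ∃ j, ¬ F₃ ∣ P₀.coeff j := by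
    by_contra hnone
    push Not at hnone
    have h𝔭eq : 𝔭 = Ideal.span {ι (Polynomial.C F₃)} := by
      refine le_antisymm ?_ ((Ideal.span_singleton_le_iff_mem _).2 hFmem)
      intro G hG
      obtain ⟨Gy, hGy⟩ := exists_embed₄_poly ι hC h0 h1 h2 hX G
      have hall : ∀ j, F₃ ∣ Gy.coeff j := hnone Gy (by rw [hGy]; exact hG)
      obtain ⟨H, hH⟩ := (Polynomial.C_dvd_iff_dvd_coeff F₃ Gy).2 hall
      rw [Ideal.mem_span_singleton, ← hGy, hH, map_mul]
      exact Dvd.intro _ rfl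
    have hFt0 : ι (Polynomial.C F₃) ≠ 0 := by
      intro h0
      apply hFirr.ne_zero
      have hzero : ∀ x₀ x₁ : ℂ, (F.map (Polynomial.evalRingHom x₀)).eval x₁ = 0 := by
        intro x₀ x₁
        have h := hev (Sum.elim ![x₀, x₁] ![0, 0]) (Polynomial.C F₃)
        rw [h0, map_zero, Polynomial.map_C, Polynomial.eval_C, hF₃] at h
        simpa using h.symm
      refine Polynomial.ext fun j => Polynomial.funext fun x₀ => ?_
      have hG : F.map (Polynomial.evalRingHom x₀) = 0 :=
        Polynomial.funext fun x₁ => by rw [hzero, Polynomial.eval_zero]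
      have hj := congrArg (fun G : ℂ[X] => G.coeff j) hG
      simp only [Polynomial.coeff_map, Polynomial.coe_evalRingHom, Polynomial.coeff_zero] at hj
      rw [Polynomial.coeff_zero, Polynomial.eval_zero]
      exact hj
    have hprime : Prime (ι (Polynomial.C F₃)) := (Ideal.span_singleton_prime hFt0).1 (h𝔭eq ▸ h𝔭p)
    have h𝔭eq' : MvPolynomial.vanishingIdeal ℂ W = Ideal.span {ι (Polynomial.C F₃)} := by
      rw [← h𝔭]; exact h𝔭eq
    set f : MvPolynomial (Fin 2 ⊕ Fin 2) ℂ ≃+* MvPolynomial (Fin 4) ℂ :=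
      (MvPolynomial.renameEquiv ℂ finSumFinEquiv).toRingEquiv with hf
    have hprime' : Prime (f (ι (Polynomial.C F₃))) := (MulEquiv.prime_iff f).2 hprime
    have hmap : Ideal.span {f (ι (Polynomial.C F₃))} =
        (Ideal.span {ι (Polynomial.C F₃)}).map
          (f : MvPolynomial (Fin 2 ⊕ Fin 2) ℂ →+* MvPolynomial (Fin 4) ℂ) := by
      rw [Ideal.map_span, Set.image_singleton]; rfl
    have hdim3 : zariskiDim ℂ W = ((4 - 1 : ℕ) : WithBot ℕ∞) := by
      rw [← Literature.RingTheory.KrullDimension.ringKrullDim_quotient_span_of_prime_mvPolynomial hprime']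
      show ringKrullDim (MvPolynomial (Fin 2 ⊕ Fin 2) ℂ ⧸ MvPolynomial.vanishingIdeal ℂ W) = _
      exact (ringKrullDim_eq_of_ringEquiv (Ideal.quotEquivOfEq h𝔭eq')).trans
        (ringKrullDim_eq_of_ringEquiv (Ideal.quotientEquiv _ _ f hmap))
    have h23 : ((2 : ℕ) : WithBot ℕ∞) = ((4 - 1 : ℕ) : WithBot ℕ∞) := by rw [← hdim3]; exact hmm.2.2.1.symm
    have := Nat.cast_injective (R := WithBot ℕ∞) h23
    omega
  obtain ⟨P₀, hP₀mem, hP₀nd⟩ := hP₀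
  -- the minimal polynomial over `B = ℂ[x₀, x₁, y₁]`
  obtain ⟨P, hP, hd, htop, hbot, hdisc, hdiv⟩ :=
    exists_minimalPolynomial_domain (ι := ι) (𝔭 := 𝔭) hprimeF₃ hFmem hconst hXmem hP₀mem hP₀nd
  -- file CI with `S = W`, `c = lc(P)`
  have hWcl : W = MvPolynomial.zeroLocus ℂ 𝔭 := eq_zeroLocus_vanishingIdeal_of_isZariskiClosed hmm.1.1
  refine unprojectedDense_relation_of_topRowRoot F hFirr hn N hN T hT hT0 hTθ F₃ hF₃ P hd htop hbot hdisc
    P.leadingCoeff htop hmm.1 (le_of_eq hmm.2.2.1) ?_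
  intro x₀ x₁ y hFx hlc hy0 hPy
  rw [hWcl, MvPolynomial.mem_zeroLocus_iff]
  intro G hG
  obtain ⟨Gy, hGy⟩ := exists_embed₄_poly ι hC h0 h1 h2 hX G
  obtain ⟨k, Q, H, hQH, hH⟩ := hdiv Gy (by rw [hGy]; exact hG)
  obtain ⟨H₁, rfl⟩ := (Polynomial.C_dvd_iff_dvd_coeff F₃ H).2 hH
  rw [MvPolynomial.aeval_eq_eval, ← hGy, hev]
  simp only [Sum.elim_inl, Sum.elim_inr, Matrix.cons_val_zero, Matrix.cons_val_one]
  have h := congrArg (fun T : Polynomial (MvPolynomial (Fin 3) ℂ) =>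
    (T.map (MvPolynomial.eval ![x₀, x₁, Complex.exp x₁])).eval y) hQH
  simp only [Polynomial.map_mul, Polynomial.map_pow, Polynomial.map_C, Polynomial.map_add,
    Polynomial.eval_mul, Polynomial.eval_pow, Polynomial.eval_C, Polynomial.eval_add] at h
  rw [hPy, hF₃] at h
  simp only [Matrix.cons_val_zero, Matrix.cons_val_one] at h
  rw [hFx, mul_zero, zero_mul, add_zero] at h
  exact (mul_eq_zero.1 h).resolve_left (pow_ne_zero _ hlc)

/-- **Example form: the conic `x₁² + x₀x₁ + x₀ = 0`** — every surface of the case over it on which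
`x₀, x₁, y₁` satisfy no relation besides the curve equation is dense. [cite: MantovaMasser2023,
§1 Further remarks, p. 5 (the question, open in general)] (new) -/
theorem unprojectedDense_of_mmCase_conicE {W : Set (Fin 2 ⊕ Fin 2 → ℂ)} (hmm : MMCaseDimPiOneFree W)
    (hbase : MvPolynomial.zeroLocus ℂ (MvPolynomial.vanishingIdeal ℂ (projAdd '' (W ∩ torusLocus ℂ 2))) =
      {x : Fin 2 → ℂ | x 1 ^ 2 + x 0 * x 1 + x 0 = 0})
    (hfree : ∀ H : MvPolynomial (Fin 3) ℂ,
      (∀ w ∈ W, MvPolynomial.eval ![w (Sum.inl 0), w (Sum.inl 1), w (Sum.inr 1)] H = 0) →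
        (MvPolynomial.X 1 ^ 2 + MvPolynomial.X 0 * MvPolynomial.X 1 + MvPolynomial.X 0 :
          MvPolynomial (Fin 3) ℂ) ∣ H) :
    UnprojectedDense W := by
  classical
  have hF₃ev : ∀ v : Fin 3 → ℂ, MvPolynomial.eval v (MvPolynomial.X 1 ^ 2 +
      MvPolynomial.X 0 * MvPolynomial.X 1 + MvPolynomial.X 0 : MvPolynomial (Fin 3) ℂ) =
      ((X ^ 2 + Polynomial.C (X : ℂ[X]) * X + Polynomial.C (X : ℂ[X]) : ℂ[X][X]).map
        (Polynomial.evalRingHom (v 0))).eval (v 1) := by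
    intro v; rw [conicE_eval]; simp
  refine unprojectedDense_of_mmCase_topRowRoot _ conicE_irreducible (by rw [conicE_natDegree]) 1
    (fun j => ?_) (X + 1) (fun j => ?_) (Polynomial.X_add_C_ne_zero 1) (θ := -1) (by simp) _ hF₃ev
    hmm (by rw [hbase]; ext x; simp only [Set.mem_setOf_eq, conicE_eval]) hfree
  · rw [conicE_coeff]; split_ifs <;> simp
  · rw [conicE_coeff, Polynomial.coeff_add, Polynomial.coeff_X, Polynomial.coeff_one]
    rcases j with _ | _ | _ | j <;> simp [Polynomial.coeff_one]

end RelationAllSurfaces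

end Summit.Schanuel.Schanuel.Theorems
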